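import Mathlib
import HarnessLib
import Literature.AlgebraicGeometry.Resolution.QuadraticTransformsUFD
import Summits.ResolutionOfSingularities.ResolutionOfSingularities.Theorems.HomologicalConductorNoZenoExitDivisor
import Summits.ResolutionOfSingularities.ResolutionOfSingularities.Theorems.HomologicalConductorNoZenoExceptionalBasePt

/-!
# Crux `NoZeno` / `NoZenoR` (stmt-ResolutionOfSingularities-16483 / -19943), line `sandwich-cluster`,
# stub S3 `stub_caPrincipalUpstairs` = (Q_val) — Layer 0: reduction to dominating two-dimensional `S`

Route `ResolutionOfSingularities/HomologicalConductor`.  OURS (cell res-hironaka, crux chain W4.4, seat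
res-L0-w44-stub-3); nothing here is a statement of the manuscript under review (Hironaka 2017);
AI-written, weaker than expert review.

Layer 0 of the lead's `STUB-PLAN-stub_caPrincipalUpstairs.md` (P0.1–P0.4), kernel-checked: the
registered stub S3 of skeleton v11/v12 asks that `ca(T_m)` generate a principal ideal in EVERY regular
local `S ⊇ T_m`.  This file reduces it to the geometric case: it suffices to treat the regular
TWO-DIMENSIONAL `S` that DOMINATE `T_m` (and then dominate `R`, so that they are iterated quadratic
transforms of `R` by Abhyankar — the «closed points of the sky and beyond»).  The other cases are
settled here:

* if some element of `ca(T_m)` is a unit of `S`, the ideal is `⊤ = (1)`; this happens whenever `S` does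
  NOT dominate `T_m` — the contraction `𝔭 = 𝔪_S ∩ T_m` is then a non-maximal prime of `T_m`, and
  `ca(T_m) ⊆ 𝔭` would force `𝔭` maximal (`isMaximal_of_ca_le`: Iyengar–Takahashi 5.4 + `R₁` of the
  normal stage) — and whenever `T_m` is regular (`ca ⊄ 𝔪`);
* if `S` dominates `T_m` and `dim S ≤ 1`, `S` is a principal ideal ring
  (`isPrincipalIdealRing_of_ringKrullDim_le_one`);
* `dim S ≤ 2` always (`ringKrullDim_le_two_of_trdeg`).

* `isPrincipal_span_of_isUnit_mem` — a span containing a unit is principal;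
* `exists_unit_mem_ca_of_not_dominates` — `S ⊇ T_m` regular local not dominating `T_m` ⇒ some
  element of `ca(T_m)` is a unit of `S`;
* **`caPrincipalUpstairs_of_dominating`** — the reduction, with the binder list of the registered stub
  followed by the residual hypothesis `H` (regular, `dim S = 2`, `S` dominates `T_m` and `R`).

References: S. Iyengar, R. Takahashi, IMRN 2016, Thm. 5.4 [`IyengarTakahashi2014`]; J. Lipman, Publ.
IHÉS 36 (1969) §12 [`Lipman1969`].
-/

noncomputable section

-- single-problem summit: the doubled namespace component `ResolutionOfSingularities` is forced
set_option linter.dupNamespace false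

namespace Summit.ResolutionOfSingularities.ResolutionOfSingularities.Theorems.NoZeno.SandwichCluster

open IsLocalRing Literature.AlgebraicGeometry.Resolution
open Summit.ResolutionOfSingularities.ResolutionOfSingularities.Theorems
open Summit.ResolutionOfSingularities.ResolutionOfSingularities.Theorems.NoZeno.Birth
open Summit.ResolutionOfSingularities.ResolutionOfSingularities.Theses.HomologicalConductor

variable {k K : Type} [Field k] [Field K] [Algebra k K]

/-- A span containing a unit is the unit ideal, hence principal. [folklore] -/
theorem isPrincipal_span_of_isUnit_mem {S : Type*} [CommRing S] {G : Set S} {u : S} (hu : u ∈ G)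
    (hunit : IsUnit u) : (Ideal.span G).IsPrincipal := by
  have htop : Ideal.span G = ⊤ := Ideal.eq_top_of_isUnit_mem _ (Ideal.subset_span hu) hunit
  rw [htop]
  exact ⟨⟨1, by simp⟩⟩

/-- **A regular local `S ⊇ T_m` that does not dominate the stage `T_m` (`m ≥ 1`) contains a unit from
`ca(T_m)`**: the non-units of `S` in `T_m` form a prime `𝔭 ⊊ 𝔪_{T_m}`, and `ca(T_m) ⊆ 𝔭` would make
`𝔭` maximal (`isMaximal_of_ca_le`). [cite: IyengarTakahashi2014, Thm. 5.4] -/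
theorem exists_unit_mem_ca_of_not_dominates (O : ValuationSubring K) (A : Subalgebra k K)
    (hk : ∀ c : k, algebraMap k K c ∈ O) (hA : A.FG) (hfr : IsFractionRing ↥A K)
    (hAO : A.toSubring ≤ O.toSubring) (htr : Algebra.trdeg k K = 2) (n : ℕ)
    (S : Subalgebra k K) [IsLocalRing ↥S] (hTS : tower O A (n + 1) ≤ S)
    (hnd : ¬ ∀ t : K, t ∈ tower O A (n + 1) → t⁻¹ ∈ S → t⁻¹ ∈ tower O A (n + 1)) :
    ∃ c : ↥S, (c : K) ∈ ca (tower O A (n + 1)) ∧ IsUnit c := by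
  classical
  haveI := hfr
  haveI : IsLocalRing ↥(tower O A (n + 1)) := by
    obtain ⟨B, hBO, hTB⟩ := exists_tower_eq_loc O A hk hAO (n + 1)
    rw [hTB, loc_eq_locAt]; exact SyzygyFlattening.isLocalRing_locAt O B hBO
  -- the contraction of `𝔪_S`
  set 𝔭 : Ideal ↥(tower O A (n + 1)) :=
    (maximalIdeal ↥S).comap (Subalgebra.inclusion hTS).toRingHom with h𝔭
  haveI : 𝔭.IsPrime := Ideal.comap_isPrime _ _
  -- `𝔭` is not maximal: some non-unit of `T` is a unit of `S`
  have hnotmax : ¬ 𝔭.IsMaximal := by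
    intro hmax
    apply hnd
    intro t ht hinv
    by_cases ht0 : t = 0
    · rw [ht0, inv_zero]; exact Subalgebra.zero_mem _
    have heq : 𝔭 = maximalIdeal _ := IsLocalRing.eq_maximalIdeal hmax
    by_contra hninT
    -- `t` is a non-unit of `T`, hence in `𝔭`, hence a non-unit of `S`
    have htm : (⟨t, ht⟩ : ↥(tower O A (n + 1))) ∈ maximalIdeal _ := by
      rw [IsLocalRing.mem_maximalIdeal, mem_nonunits_iff]
      exact fun hu => hninT (inv_mem_of_isUnit hu)
    rw [← heq, h𝔭, Ideal.mem_comap] at htm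
    have hnu : ¬ IsUnit (Subalgebra.inclusion hTS ⟨t, ht⟩) :=
      (IsLocalRing.mem_maximalIdeal _).mp htm
    exact hnu (isUnit_of_inv_mem (by exact ht0) hinv)
  -- hence `ca ⊄ 𝔭`
  have hnle : ¬ Literature.RingTheory.CohomologyAnnihilator.ca ↥(tower O A (n + 1)) ≤ 𝔭 :=
    fun hle => hnotmax (isMaximal_of_ca_le O A hk hA hfr hAO htr n 𝔭 hle)
  obtain ⟨g, hg, hg𝔭⟩ := Set.not_subset.mp hnle
  refine ⟨Subalgebra.inclusion hTS g, ?_, ?_⟩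
  · rw [Subalgebra.coe_inclusion]
    rw [Literature.RingTheory.CohomologyAnnihilator.ca_eq_cohomologyAnnihilator] at hg
    exact (tn_coe_mem_ca_iff _ g).mpr hg
  · by_contra hnu
    apply hg𝔭
    change g ∈ 𝔭
    rw [h𝔭, Ideal.mem_comap]
    exact (IsLocalRing.mem_maximalIdeal _).mpr hnu

/-- **Layer 0 of S3 (lead's STUB-PLAN P0.1–P0.4): reduction of `stub_caPrincipalUpstairs` to the
regular two-dimensional `S` dominating the stage.**  With the binders of the registered stub: if
`ca(T_m)·S` is principal for every regular local `S ⊇ T_m` of dimension two that dominates `T_m`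
(hypothesis `H`; such `S` also dominate `R`, given for free), then it is principal for every regular
local `S ⊇ T_m`. [cite: IyengarTakahashi2014, Thm. 5.4] -/
theorem caPrincipalUpstairs_of_dominating (p : ℕ) (hp : p.Prime) (k K : Type) [Field k] [CharP k p]
    [Field K] [Algebra k K] (O : ValuationSubring K) (A R : Subalgebra k K) (m₀ : ℕ)
    (ctx : SandwichCtx O A R m₀) (m : ℕ) (hm : m₀ + 1 ≤ m)
    (H : ∀ S : Subalgebra k K, tower O A m ≤ S → IsRegularLocalRing ↥S → ringKrullDim ↥S = 2 →
      (∀ t : K, t ∈ tower O A m → t⁻¹ ∈ S → t⁻¹ ∈ tower O A m) →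
      SubringDominates R.toSubring S.toSubring →
      (Ideal.span {s : ↥S | (s : K) ∈ ca (tower O A m)}).IsPrincipal)
    (S : Subalgebra k K) (hTS : tower O A m ≤ S) (hS : IsRegularLocalRing ↥S) :
    (Ideal.span {s : ↥S | (s : K) ∈ ca (tower O A m)}).IsPrincipal := by
  classical
  have _hchar : p.Prime := hp
  obtain ⟨hk, hA, hfr, hAO, htr, hRreg, hRfr, hRO, hlocR, hRle⟩ := ctx
  haveI := hS
  haveI := hfr
  obtain ⟨n, rfl⟩ : ∃ n, m = n + 1 := ⟨m - 1, by omega⟩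
  -- a unit of `S` in `ca(T_m)` makes the ideal `⊤`
  by_cases hdom : ∀ t : K, t ∈ tower O A (n + 1) → t⁻¹ ∈ S → t⁻¹ ∈ tower O A (n + 1)
  swap
  · obtain ⟨c, hc, hcu⟩ := exists_unit_mem_ca_of_not_dominates O A hk hA hfr hAO htr n S hTS hdom
    exact isPrincipal_span_of_isUnit_mem hc hcu
  -- `S` dominates `T_m`, hence `R`
  have hRT : R ≤ tower O A (n + 1) := hRle _ (by omega)
  have hTO : (tower O A (n + 1)).toSubring ≤ O.toSubring := (tn_tower_invariant O A hk hA hfr hAO _).2.1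
  have hRO' : SubringDominates R.toSubring O.toSubring := by
    refine ⟨hRO, fun r hr hinv => ?_⟩
    have h : r⁻¹ ∈ loc O R :=
      Algebra.subset_adjoin ⟨1, R.one_mem, r, hr, hinv, (one_mul _).symm⟩
    rw [hlocR] at h
    exact h
  have hdomT := valuationSubring_dominates_tower O A hk hAO (n + 1)
  have hRS : SubringDominates R.toSubring S.toSubring := by
    refine ⟨fun z hz => hTS (hRT hz), fun r hr hinv => ?_⟩
    have h1 : r⁻¹ ∈ tower O A (n + 1) := hdom r (hRT hr) hinv
    exact hRO'.2 r hr (hTO h1)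
  -- `dim S ≤ 2`; if `dim S ≤ 1`, `S` is a principal ideal ring
  have hdim2 : ringKrullDim ↥S ≤ 2 := ringKrullDim_le_two_of_trdeg htr S
  by_cases hdim1 : ringKrullDim ↥S ≤ 1
  · haveI : IsPrincipalIdealRing ↥S := isPrincipalIdealRing_of_ringKrullDim_le_one hdim1
    exact IsPrincipalIdealRing.principal _
  have hdim : ringKrullDim ↥S = 2 :=
    le_antisymm hdim2 (RuledResiduesRegularModelRuled.two_le_ringKrullDim_of_not_le_one hdim1)
  exact H S hTS hS hdim hdom hRS

end Summit.ResolutionOfSingularities.ResolutionOfSingularities.Theorems.NoZeno.SandwichCluster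

end
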